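import Literature.NumberTheory.EllipticCurves.ManinSymbolsWeightKGamma1RankAllWeights
import Literature.NumberTheory.EllipticCurves.NewformsSpanGamma1Proofs
import Literature.NumberTheory.EllipticCurves.NewformGaloisRepIntegralityProofs
import Literature.LinearAlgebra.BaseChange.RationalRelations
import HarnessLib

/-!
# Deligne–Serre 1974, Prop. 2.7 (2.7.2) at every level: descent of the level through the
# degeneracy map `[α_p]_k`, and the discharge `DeligneSerre1974_span_integralLattice1_holds`

The named fact `DeligneSerre1974_span_integralLattice1 N k`
(`NewformGaloisRepIntegralityProofs`) is Deligne–Serre's (2.7.2): for `k ≥ 1` the `ℤ`-module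
`L = integralLattice1 N k` of cusp forms on `Γ₁(N)` all of whose diamond twists have Fourier
coefficients in `ℤ` spans `S_k(Γ₁(N))` over `ℂ` (Deligne–Serre 1974, Prop. 2.7: *"`L ⊗ ℂ → S_ℂ`
est un isomorphisme"*, proved there from the modular stack (2.6.1); for `k ≥ 2` it is Shimura 1971,
Thm. 3.52).  The tree proves it for every weight at every level `N ≥ 5`
(`ManinK.span_integralLattice1_of_five_le`, `ManinSymbolsWeightKGamma1RankAllWeights`: the rank
half of Eichler–Shimura for `Γ₁(N)` by weight-`k` Manin symbols, Shimura's Hecke-stable real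
lattice (3.5.20), the real structure `f ↦ f^ε`, and the `E₄`/`E₆` weight descent).  The levels
`N ≤ 4` have elliptic points or irregular cusps; instead of redoing the count there, this file
**descends the level**:

* `LevelDescent.exists_degeneracyMap1_eq` — for a prime `p ∤ N`, a cusp form `G ∈ S_k(Γ₁(Np))`
  whose Fourier coefficients vanish off the multiples of `p` is `[α_p]_k F` for a cusp form
  `F ∈ S_k(Γ₁(N))` (`[α_p]_k = degeneracyMap1 N (Np) p k`, `a_n([α_p]_k F) = p^{k-1} a_{n/p}(F)`,
  `cuspCoeff_degeneracyMap1`; Diamond–Shurman §5.7: the image of `ι_p` is the space of forms in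
  `q^p`).  Proof: `G(τ + 1/p) = G(τ)` by the `q`-expansion (`apply_vadd_eq_of_cuspCoeff`), so the
  stabiliser of `G ∣[k] β`, `β = diag(1, p)`, in `SL(2, ℤ)` contains `T` (`β T β⁻¹` is that
  translation) and `{(a b; c d) : a ≡ d ≡ 1 (Np), N ∣ c, p ∣ b}` (`β γ β⁻¹ ∈ Γ₁(Np)`), which
  generate `Γ₁(N)` when `p ∤ N` (`gamma1_le_of_mem`, row reduction modulo `p`); holomorphy and
  vanishing at the cusps of `G ∣[k] β` are Mathlib's `CuspForm.translate` (both levels are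
  arithmetic, with cusp set `ℙ¹(ℚ)`), and `[α_p]_k (G ∣[k] β) = p^{k-2} G` (`β α_p = p·1`).
* `LevelDescent.DeligneSerre1974_span_integralLattice1.of_mul_prime` — **(2.7.2) at level `Np`
  implies (2.7.2) at level `N`** (`p` prime, `p ∤ N`): the image of `[α_p]_k` is cut out by the
  vanishing of the coefficients `a_n`, `p ∤ n`, which are `ℤ`-valued on the lattice of level `Np`,
  so it is spanned by rational combinations of lattice vectors
  (`Literature.LinearAlgebra.BaseChange.exists_algebraMap_coords`, exactly as in the weight descent
  `DeligneSerre1974_span_integralLattice1.of_weight_add`); a rational combination `[α_p]_k F` has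
  `p^{k-1} D F ∈ L_N` since the diamond operators commute with `[α_p]_k`
  (`diamondOp_degeneracyMap1`) and `(ℤ/Npℤ)ˣ → (ℤ/Nℤ)ˣ` is onto.
* **`DeligneSerre1974_span_integralLattice1_holds : DeligneSerre1974_span_integralLattice1 N k`**
  — every `N ≥ 1`, every `k`: for `N ≥ 5` by `span_integralLattice1_of_five_le`, for `N ≤ 4` by
  descent from the level `5N ∈ {5, 10, 15, 20}` with `p = 5`.

Everything here is proved; no named facts are introduced.

## References

* P. Deligne, J.-P. Serre, *Formes modulaires de poids 1*, Ann. Sci. ÉNS (4) 7 (1974), 507–530,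
  Prop. 2.7 (2.7.2), Rem. 2.8 (p. 512). doi:10.24033/asens.1277
* G. Shimura, *Introduction to the arithmetic theory of automorphic functions*, Publ. Math. Soc.
  Japan 11 (1971), Thm. 3.52.
* F. Diamond, J. Shurman, *A first course in modular forms*, GTM 228 (2005), §5.6–5.7 (the
  degeneracy maps `[α_d]_k`, `ι_d`), Prop. 5.6.2.
-/

noncomputable section

open scoped MatrixGroups ModularForm
open CongruenceSubgroup UpperHalfPlane ModularForm Matrix.SpecialLinearGroup ConjAct Pointwise
  ModularGroup

namespace Literature.NumberTheory.EllipticCurves.ModularForms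

namespace LevelDescent

/-! ### 1. Group theory: `Γ₁(N)` is generated by `T` and `Γ₁(N) ∩ Γ₁(p)-type ∩ Γ⁰(p)` (`p ∤ N`) -/

section GroupTheory

/-- `(a : ZMod N) = 1 ↔ N ∣ a - 1` for `a ∈ ℤ`. [folklore] -/
theorem intCast_eq_one_iff {N : ℕ} (a : ℤ) : (a : ZMod N) = 1 ↔ (N : ℤ) ∣ a - 1 := by
  rw [show (1 : ZMod N) = ((1 : ℤ) : ZMod N) by simp, ZMod.intCast_eq_intCast_iff_dvd_sub,
    dvd_sub_comm]

/-- Membership in `Γ₁(N)` by divisibilities. [folklore] -/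
theorem mem_gamma1_iff {N : ℕ} (γ : SL(2, ℤ)) : γ ∈ Gamma1 N ↔
    (N : ℤ) ∣ γ 0 0 - 1 ∧ (N : ℤ) ∣ γ 1 1 - 1 ∧ (N : ℤ) ∣ γ 1 0 := by
  rw [Gamma1_mem, intCast_eq_one_iff, intCast_eq_one_iff, ZMod.intCast_zmod_eq_zero_iff_dvd]

/-- Entries of `Tʲ γ`. [folklore] -/
theorem T_zpow_mul_apply (j : ℤ) (γ : SL(2, ℤ)) :
    (T ^ j * γ) 0 0 = γ 0 0 + j * γ 1 0 ∧ (T ^ j * γ) 0 1 = γ 0 1 + j * γ 1 1 ∧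
      (T ^ j * γ) 1 0 = γ 1 0 ∧ (T ^ j * γ) 1 1 = γ 1 1 := by
  refine ⟨?_, ?_, ?_, ?_⟩ <;>
    simp [Matrix.SpecialLinearGroup.coe_mul, ModularGroup.coe_T_zpow, Matrix.mul_apply,
      Fin.sum_univ_two]

/-- Entries of `γ Tᵐ`. [folklore] -/
theorem mul_T_zpow_apply (m : ℤ) (γ : SL(2, ℤ)) :
    (γ * T ^ m) 0 0 = γ 0 0 ∧ (γ * T ^ m) 0 1 = γ 0 0 * m + γ 0 1 ∧
      (γ * T ^ m) 1 0 = γ 1 0 ∧ (γ * T ^ m) 1 1 = γ 1 0 * m + γ 1 1 := by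
  refine ⟨?_, ?_, ?_, ?_⟩ <;>
    simp [Matrix.SpecialLinearGroup.coe_mul, ModularGroup.coe_T_zpow, Matrix.mul_apply,
      Fin.sum_univ_two]

/-- The lower unipotent `L_N = (1 0; N 1)`. [folklore] -/
def lowerU (N : ℤ) : SL(2, ℤ) := ⟨!![1, 0; N, 1], by simp [Matrix.det_fin_two_of]⟩

/-- Upper-left entry of `L_N`. [folklore] -/
@[simp] theorem lowerU_apply_00 (N : ℤ) : lowerU N 0 0 = 1 := rfl

/-- Upper-right entry of `L_N`. [folklore] -/
@[simp] theorem lowerU_apply_01 (N : ℤ) : lowerU N 0 1 = 0 := rfl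

/-- Lower-left entry of `L_N`. [folklore] -/
@[simp] theorem lowerU_apply_10 (N : ℤ) : lowerU N 1 0 = N := rfl

/-- Lower-right entry of `L_N`. [folklore] -/
@[simp] theorem lowerU_apply_11 (N : ℤ) : lowerU N 1 1 = 1 := rfl

/-- Entries of `L_N γ`. [folklore] -/
theorem lowerU_mul_apply (N : ℤ) (γ : SL(2, ℤ)) :
    (lowerU N * γ) 0 0 = γ 0 0 ∧ (lowerU N * γ) 0 1 = γ 0 1 ∧
      (lowerU N * γ) 1 0 = N * γ 0 0 + γ 1 0 ∧ (lowerU N * γ) 1 1 = N * γ 0 1 + γ 1 1 := by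
  refine ⟨?_, ?_, ?_, ?_⟩ <;>
    simp [Matrix.SpecialLinearGroup.coe_mul, lowerU, Matrix.mul_apply, Fin.sum_univ_two]

/-- `a d - b c = 1`. [folklore] -/
theorem det_eq_one (γ : SL(2, ℤ)) : γ 0 0 * γ 1 1 - γ 0 1 * γ 1 0 = 1 := by
  have h := Matrix.det_fin_two (γ : Matrix (Fin 2) (Fin 2) ℤ)
  rw [γ.det_coe] at h
  linarith

/-- **Generation lemma**: for a prime `p ∤ N`, a subgroup of `SL(2, ℤ)` containing `T` and every
`γ = (a b; c d)` with `a ≡ d ≡ 1 (mod Np)`, `N ∣ c`, `p ∣ b` contains `Γ₁(N)` (row reduction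
modulo `p`: `SL(2, ℤ/p)` is generated by the two unipotent subgroups). [folklore] -/
theorem gamma1_le_of_mem {N p : ℕ} (hp : p.Prime) (hpN : ¬ p ∣ N) (K : Subgroup SL(2, ℤ))
    (hT : T ∈ K)
    (hK : ∀ γ : SL(2, ℤ), (N * p : ℤ) ∣ γ 0 0 - 1 → (N * p : ℤ) ∣ γ 1 1 - 1 → (N : ℤ) ∣ γ 1 0 →
      (p : ℤ) ∣ γ 0 1 → γ ∈ K) :
    Gamma1 N ≤ K := by
  have hpZ : Prime (p : ℤ) := Nat.prime_iff_prime_int.mp hp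
  have hNp : IsCoprime (N : ℤ) p := by
    rw [Int.isCoprime_iff_gcd_eq_one, Int.gcd_natCast_natCast]
    exact (Nat.Coprime.symm ((Nat.Prime.coprime_iff_not_dvd hp).mpr hpN))
  -- Step A: `p ∤ c`
  have stepA : ∀ γ : SL(2, ℤ), (N : ℤ) ∣ γ 0 0 - 1 → (N : ℤ) ∣ γ 1 1 - 1 → (N : ℤ) ∣ γ 1 0 →
      ¬ (p : ℤ) ∣ γ 1 0 → γ ∈ K := by
    intro γ ha hd hc hpc
    have hcop : IsCoprime (γ 1 0 : ℤ) p := by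
      rw [Int.isCoprime_iff_gcd_eq_one]
      have h1 : Int.gcd (γ 1 0) p = Nat.gcd (γ 1 0).natAbs p := by
        rw [Int.gcd_eq_natAbs]; rfl
      rw [h1, Nat.gcd_comm]
      refine (Nat.Prime.coprime_iff_not_dvd hp).mpr fun h ↦ hpc ?_
      exact Int.ofNat_dvd_left.mpr h
    obtain ⟨u, v, huv⟩ := hcop
    set j : ℤ := u * (1 - γ 0 0) with hj
    set γ₂ : SL(2, ℤ) := T ^ j * γ with hγ₂
    obtain ⟨e00, e01, e10, e11⟩ := T_zpow_mul_apply j γ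
    have ha₂ : (p : ℤ) ∣ γ₂ 0 0 - 1 := by
      refine ⟨-((1 - γ 0 0) * v), ?_⟩
      rw [e00, hj]
      linear_combination (1 - γ 0 0) * huv
    have ha₂N : (N : ℤ) ∣ γ₂ 0 0 - 1 := by
      rw [e00, show γ 0 0 + j * γ 1 0 - 1 = (γ 0 0 - 1) + j * γ 1 0 by ring]
      exact dvd_add ha (dvd_mul_of_dvd_right hc _)
    set m : ℤ := -γ₂ 0 1 with hm
    set γ₃ : SL(2, ℤ) := γ₂ * T ^ m with hγ₃
    obtain ⟨f00, f01, f10, f11⟩ := mul_T_zpow_apply m γ₂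
    have hb₃ : (p : ℤ) ∣ γ₃ 0 1 := by
      rw [f01, hm, show γ₂ 0 0 * -γ₂ 0 1 + γ₂ 0 1 = -(γ₂ 0 1) * (γ₂ 0 0 - 1) by ring]
      exact dvd_mul_of_dvd_right ha₂ _
    have ha₃ : (N * p : ℤ) ∣ γ₃ 0 0 - 1 := by
      rw [f00]
      exact hNp.mul_dvd ha₂N ha₂
    have hc₃ : (N : ℤ) ∣ γ₃ 1 0 := by
      rw [f10, e10]; exact hc
    have hd₃ : (N * p : ℤ) ∣ γ₃ 1 1 - 1 := by
      refine hNp.mul_dvd ?_ ?_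
      · rw [f11, e11, e10, show γ 1 0 * m + γ 1 1 - 1 = γ 1 0 * m + (γ 1 1 - 1) by ring]
        exact dvd_add (dvd_mul_of_dvd_left hc _) hd
      · have hdet := det_eq_one γ₃
        have : γ₃ 1 1 - 1 = -(γ₃ 1 1 * (γ₃ 0 0 - 1)) + γ₃ 0 1 * γ₃ 1 0 := by linear_combination hdet
        rw [this]
        exact dvd_add (dvd_neg.mpr (dvd_mul_of_dvd_right ha₂ _ |>.trans (by rw [f00])))
          (dvd_mul_of_dvd_left hb₃ _)
    have h₃ : γ₃ ∈ K := hK γ₃ ha₃ hd₃ hc₃ hb₃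
    have h₂ : γ₂ ∈ K := by
      have : γ₂ = γ₃ * (T ^ m)⁻¹ := by rw [hγ₃, mul_inv_cancel_right]
      rw [this]
      exact K.mul_mem h₃ (K.inv_mem (K.zpow_mem hT m))
    have : γ = (T ^ j)⁻¹ * γ₂ := by rw [hγ₂, inv_mul_cancel_left]
    rw [this]
    exact K.mul_mem (K.inv_mem (K.zpow_mem hT j)) h₂
  -- Step B
  intro γ hγ
  obtain ⟨ha, hd, hc⟩ := (mem_gamma1_iff γ).mp hγ
  by_cases hpc : (p : ℤ) ∣ γ 1 0
  · have hL : lowerU N ∈ K := hK _ (by simp) (by simp) (by simp) (by simp)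
    set γ₁ : SL(2, ℤ) := lowerU N * γ with hγ₁
    obtain ⟨g00, g01, g10, g11⟩ := lowerU_mul_apply N γ
    have h₁ : γ₁ ∈ K := by
      refine stepA γ₁ (by rw [g00]; exact ha) ?_ ?_ ?_
      · rw [g11, show (N : ℤ) * γ 0 1 + γ 1 1 - 1 = N * γ 0 1 + (γ 1 1 - 1) by ring]
        exact dvd_add (dvd_mul_right _ _) hd
      · rw [g10]
        exact dvd_add (dvd_mul_right _ _) hc
      · rw [g10]
        intro h
        have hpa : (p : ℤ) ∣ N * γ 0 0 := (dvd_add_left hpc).mp h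
        rcases hpZ.dvd_or_dvd hpa with hpN' | hpa'
        · exact hpN (Int.natCast_dvd_natCast.mp hpN')
        · have hdet := det_eq_one γ
          have : (p : ℤ) ∣ 1 := by
            rw [← hdet]
            exact dvd_sub (dvd_mul_of_dvd_left hpa' _) (dvd_mul_of_dvd_right hpc _)
          exact hpZ.not_dvd_one this
    have : γ = (lowerU N)⁻¹ * γ₁ := by rw [hγ₁, inv_mul_cancel_left]
    rw [this]
    exact K.mul_mem (K.inv_mem hL) h₁
  · exact stepA γ ha hd hc hpc

end GroupTheory


/-! ### 2. The matrices `β = diag(1, p)`, `α_p = diag(p, 1)`, the translation by `1/p` -/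

section Matrices

variable (p : ℕ) [NeZero p]

/-- `β = diag(1, p) ∈ GL(2, ℚ)⁺`. [folklore] -/
abbrev betaQ : GL(2, ℚ)⁺ := diagGL 1 (p : ℚ) one_pos (Nat.cast_pos.mpr (NeZero.pos p))

/-- `α_p = diag(p, 1) ∈ GL(2, ℚ)⁺` (the matrix of the degeneracy map `[α_p]_k`). [folklore] -/
abbrev alphaQ : GL(2, ℚ)⁺ := diagGL (p : ℚ) 1 (Nat.cast_pos.mpr (NeZero.pos p)) one_pos

/-- The translation `(1 1/p; 0 1) ∈ GL(2, ℚ)⁺`. [folklore] -/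
def translQ : GL(2, ℚ)⁺ :=
  ⟨Matrix.GeneralLinearGroup.mkOfDetNeZero !![1, (p : ℚ)⁻¹; 0, 1] (by simp [Matrix.det_fin_two]),
    by simp [Matrix.mem_glpos, Matrix.det_fin_two]⟩

omit [NeZero p] in
/-- The underlying matrix of `translQ p`. [folklore] -/
@[simp] theorem coe_coe_translQ :
    ((translQ p : GL (Fin 2) ℚ) : Matrix (Fin 2) (Fin 2) ℚ) = !![1, (p : ℚ)⁻¹; 0, 1] := rfl

variable {p}

/-- For `γ = (a b; c d) ∈ SL(2, ℤ)` with `b = p b'`: the integral matrix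
`β γ β⁻¹ = (a b'; p c d)`. [folklore] -/
def betaConj (γ : SL(2, ℤ)) (b' : ℤ) (hb : γ 0 1 = p * b') : SL(2, ℤ) :=
  ⟨!![γ 0 0, b'; p * γ 1 0, γ 1 1], by
    rw [Matrix.det_fin_two_of]
    have h := det_eq_one γ
    rw [hb] at h
    linear_combination h⟩

omit [NeZero p] in
/-- Entries of `betaConj`. [folklore] -/
theorem betaConj_apply (γ : SL(2, ℤ)) (b' : ℤ) (hb : γ 0 1 = p * b') :
    betaConj γ b' hb 0 0 = γ 0 0 ∧ betaConj γ b' hb 0 1 = b' ∧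
      betaConj γ b' hb 1 0 = p * γ 1 0 ∧ betaConj γ b' hb 1 1 = γ 1 1 :=
  ⟨rfl, rfl, rfl, rfl⟩

/-- **`β γ = (β γ β⁻¹) β`** in `GL(2, ℝ)`. [folklore] -/
theorem beta_mul_mapGL (γ : SL(2, ℤ)) (b' : ℤ) (hb : γ 0 1 = p * b') :
    glCast (betaQ p : GL (Fin 2) ℚ) * mapGL ℝ γ =
      mapGL ℝ (betaConj γ b' hb) * glCast (betaQ p : GL (Fin 2) ℚ) := by
  ext i j
  fin_cases i <;> fin_cases j <;>
    simp [Matrix.mul_apply, Fin.sum_univ_two, glCast, diagGL, betaConj, hb, mul_comm]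

/-- **`β T = U β`** with `U` the translation by `1/p`. [folklore] -/
theorem beta_mul_T :
    glCast (betaQ p : GL (Fin 2) ℚ) * mapGL ℝ T =
      glCast (translQ p : GL (Fin 2) ℚ) * glCast (betaQ p : GL (Fin 2) ℚ) := by
  have hp : (p : ℝ) ≠ 0 := Nat.cast_ne_zero.mpr (NeZero.ne p)
  ext i j
  fin_cases i <;> fin_cases j <;>
    simp [Matrix.mul_apply, Fin.sum_univ_two, glCast, diagGL, translQ, ModularGroup.coe_T, hp]

/-- **`β α_p = p · 1`** (`= diag(p, p)`). [folklore] -/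
theorem beta_mul_alpha :
    glCast (betaQ p : GL (Fin 2) ℚ) * glCast (alphaQ p : GL (Fin 2) ℚ) =
      glCast (diagGL (p : ℚ) (p : ℚ) (Nat.cast_pos.mpr (NeZero.pos p))
        (Nat.cast_pos.mpr (NeZero.pos p)) : GL (Fin 2) ℚ) := by
  ext i j
  fin_cases i <;> fin_cases j <;>
    simp [Matrix.mul_apply, Fin.sum_univ_two, glCast, diagGL]

variable (p) in
/-- **Slash by the scalar matrix `p · 1` is multiplication by `p^{k-2}`.** [folklore] -/
theorem slash_diagGL_self (k : ℤ) (f : ℍ → ℂ) :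
    f ∣[k] glCast (diagGL (p : ℚ) (p : ℚ) (Nat.cast_pos.mpr (NeZero.pos p))
        (Nat.cast_pos.mpr (NeZero.pos p)) : GL (Fin 2) ℚ) = ((p : ℂ) ^ (k - 2)) • f := by
  have hp0 : (p : ℝ) ≠ 0 := Nat.cast_ne_zero.mpr (NeZero.ne p)
  have hpC : (p : ℂ) ≠ 0 := Nat.cast_ne_zero.mpr (NeZero.ne p)
  set g : GL (Fin 2) ℚ := (diagGL (p : ℚ) (p : ℚ) (Nat.cast_pos.mpr (NeZero.pos p))
        (Nat.cast_pos.mpr (NeZero.pos p)) : GL (Fin 2) ℚ) with hg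
  funext τ
  have hτ : glCast g • τ = τ := by
    apply UpperHalfPlane.ext
    rw [UpperHalfPlane.glPos_smul_def (det_glCast_pos _)]
    simp [glCast, UpperHalfPlane.num, UpperHalfPlane.denom, diagGL]
    field_simp
  have hdet : ((((glCast g).det : ℝˣ) : ℝ)) = (p : ℝ) * p := by
    simp [glCast, Matrix.GeneralLinearGroup.map_det, diagGL, Matrix.det_fin_two, hg]
  have habs : |(((glCast g).det : ℝˣ) : ℝ)| = (p : ℝ) * p := by
    rw [hdet]; exact abs_of_nonneg (by positivity)
  have hdenom : UpperHalfPlane.denom (glCast g) τ = p := by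
    simp [UpperHalfPlane.denom, glCast, diagGL, hg]
  rw [ModularForm.slash_apply, σ_glCast, hτ, habs, hdenom, Pi.smul_apply, smul_eq_mul]
  push_cast
  rw [show ((p : ℂ) * p) = (p : ℂ) ^ (2 : ℤ) by rw [zpow_two], ← zpow_mul, mul_assoc,
    ← zpow_add₀ hpC, mul_comm]
  congr 1
  ring

variable (p) in
omit [NeZero p] in
/-- The translation acts by `τ ↦ τ + 1/p`. [folklore] -/
theorem translQ_smul (τ : ℍ) : glCast (translQ p : GL (Fin 2) ℚ) • τ = ((p : ℝ)⁻¹) +ᵥ τ := by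
  apply UpperHalfPlane.ext
  rw [UpperHalfPlane.glPos_smul_def (det_glCast_pos _), UpperHalfPlane.coe_vadd]
  simp [glCast, UpperHalfPlane.num, UpperHalfPlane.denom, translQ]
  ring

variable (p) in
omit [NeZero p] in
/-- **Slash by the translation: `(f ∣[k] U) τ = f(τ + 1/p)`.** [folklore] -/
theorem slash_translQ_apply (k : ℤ) (f : ℍ → ℂ) (τ : ℍ) :
    (f ∣[k] glCast (translQ p : GL (Fin 2) ℚ)) τ = f (((p : ℝ)⁻¹) +ᵥ τ) := by
  have hdet : ((((glCast (translQ p : GL (Fin 2) ℚ)).det : ℝˣ) : ℝ)) = 1 := by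
    simp [glCast, Matrix.GeneralLinearGroup.map_det, translQ, Matrix.det_fin_two]
  have hdenom : UpperHalfPlane.denom (glCast (translQ p : GL (Fin 2) ℚ)) τ = 1 := by
    simp [UpperHalfPlane.denom, glCast, translQ]
  rw [ModularForm.slash_apply, σ_glCast, translQ_smul, hdet, hdenom]
  simp

end Matrices

/-! ### 3. Forms with `q`-expansion in `q^p`: invariance under `τ ↦ τ + 1/p` -/

section Transl

variable {M : ℕ} {k : ℤ} {p : ℕ} [NeZero p]

omit [NeZero p] in
/-- `𝕢₁(τ + 1/p) = e^{2πi/p} 𝕢₁(τ)`. [folklore] -/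
theorem qParam_vadd (τ : ℍ) :
    Function.Periodic.qParam 1 (((((p : ℝ)⁻¹) +ᵥ τ : ℍ) : ℂ)) =
      Complex.exp (2 * Real.pi * Complex.I * (p : ℂ)⁻¹) * Function.Periodic.qParam 1 τ := by
  rw [UpperHalfPlane.coe_vadd]
  simp only [Function.Periodic.qParam, Complex.ofReal_one, div_one, ← Complex.exp_add]
  congr 1
  push_cast
  ring

/-- `(e^{2πi/p})^{n} = 1` for `p ∣ n`. [folklore] -/
theorem exp_pow_eq_one_of_dvd {n : ℕ} (hn : p ∣ n) :
    Complex.exp (2 * Real.pi * Complex.I * (p : ℂ)⁻¹) ^ n = 1 := by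
  obtain ⟨m, rfl⟩ := hn
  have hp : (p : ℂ) ≠ 0 := Nat.cast_ne_zero.mpr (NeZero.ne p)
  rw [← Complex.exp_nat_mul, show ((p * m : ℕ) : ℂ) * (2 * Real.pi * Complex.I * (p : ℂ)⁻¹) =
    m * (2 * Real.pi * Complex.I) by push_cast; field_simp]
  exact Complex.exp_nat_mul_two_pi_mul_I m

/-- **A cusp form on `Γ₁(M)` whose Fourier coefficients vanish off the multiples of `p` is
invariant under `τ ↦ τ + 1/p`** (`f(τ) = ∑ a_n e^{2πinτ}`). [folklore] -/
theorem apply_vadd_eq_of_cuspCoeff (G : CuspForm (Gamma1 M) k)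
    (hG : ∀ n, ¬ p ∣ n → cuspCoeff G n = 0) (τ : ℍ) :
    G (((p : ℝ)⁻¹) +ᵥ τ) = G τ := by
  have hΓ := HeckeTGamma1.one_mem_strictPeriods_Gamma1 M
  have h1 := hasSum_qExpansion_of_mem_strictPeriods one_pos hΓ G (((p : ℝ)⁻¹) +ᵥ τ)
  have h2 := hasSum_qExpansion_of_mem_strictPeriods one_pos hΓ G τ
  have heq : (fun m : ℕ ↦ (qExpansion 1 ⇑G).coeff m •
      Function.Periodic.qParam 1 (((((p : ℝ)⁻¹) +ᵥ τ : ℍ) : ℂ)) ^ m) =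
      fun m : ℕ ↦ (qExpansion 1 ⇑G).coeff m • Function.Periodic.qParam 1 τ ^ m := by
    funext m
    by_cases hm : p ∣ m
    · rw [qParam_vadd, mul_pow, exp_pow_eq_one_of_dvd hm, one_mul]
    · have : (qExpansion 1 ⇑G).coeff m = 0 := hG m hm
      simp [this]
  rw [heq] at h1
  exact h1.unique h2

/-- The same in slash form: `G ∣[k] U = G` for the translation `U` by `1/p`. [folklore] -/
theorem slash_translQ_eq_of_cuspCoeff (G : CuspForm (Gamma1 M) k)
    (hG : ∀ n, ¬ p ∣ n → cuspCoeff G n = 0) :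
    (⇑G : ℍ → ℂ) ∣[k] glCast (translQ p : GL (Fin 2) ℚ) = ⇑G := by
  funext τ
  rw [slash_translQ_apply, apply_vadd_eq_of_cuspCoeff G hG]

end Transl

/-! ### 4. Descent of the level: `G = [α_p]_k F` -/

section Descend

variable {N : ℕ} [NeZero N] {p : ℕ} [NeZero p] {k : ℤ}

/-- The stabiliser in `SL(2, ℤ)` of a function under the weight-`k` slash action. [folklore] -/
def slashStab (k : ℤ) (H : ℍ → ℂ) : Subgroup SL(2, ℤ) where
  carrier := {γ | H ∣[k] (mapGL ℝ γ) = H}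
  mul_mem' {a b} ha hb := by
    change H ∣[k] mapGL ℝ (a * b) = H
    rw [map_mul, SlashAction.slash_mul, show H ∣[k] mapGL ℝ a = H from ha]
    exact hb
  one_mem' := by
    change H ∣[k] mapGL ℝ 1 = H
    rw [map_one, SlashAction.slash_one]
  inv_mem' {a} ha := by
    change H ∣[k] mapGL ℝ a⁻¹ = H
    change H ∣[k] mapGL ℝ a = H at ha
    conv_lhs => rw [← ha]
    rw [← SlashAction.slash_mul, ← map_mul, mul_inv_cancel, map_one, SlashAction.slash_one]

omit [NeZero N] in
/-- **The key invariance**: for `G ∈ S_k(Γ₁(Np))` with `a_n(G) = 0` whenever `p ∤ n` (`p` prime,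
`p ∤ N`), the function `G ∣[k] β`, `β = diag(1, p)`, is invariant under `Γ₁(N)`: its stabiliser
contains `T` (`β T β⁻¹` is the translation by `1/p`) and `β⁻¹ Γ₁(Np) β ∩ SL(2, ℤ) ⊇
{a ≡ d ≡ 1 (Np), N ∣ c, p ∣ b}`, which generate `Γ₁(N)` (`gamma1_le_of_mem`). [folklore] -/
theorem gamma1_le_slashStab (hp : p.Prime) (hpN : ¬ p ∣ N) (G : CuspForm (Gamma1 (N * p)) k)
    (hG : ∀ n, ¬ p ∣ n → cuspCoeff G n = 0) :
    Gamma1 N ≤ slashStab k ((⇑G : ℍ → ℂ) ∣[k] glCast (betaQ p : GL (Fin 2) ℚ)) := by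
  refine gamma1_le_of_mem hp hpN _ ?_ ?_
  · change ((⇑G : ℍ → ℂ) ∣[k] glCast (betaQ p : GL (Fin 2) ℚ)) ∣[k] mapGL ℝ T = _
    rw [← SlashAction.slash_mul, beta_mul_T, SlashAction.slash_mul,
      slash_translQ_eq_of_cuspCoeff G hG]
  · intro γ ha hd hc hb
    obtain ⟨b', hb'⟩ := hb
    change ((⇑G : ℍ → ℂ) ∣[k] glCast (betaQ p : GL (Fin 2) ℚ)) ∣[k] mapGL ℝ γ = _
    rw [← SlashAction.slash_mul, beta_mul_mapGL γ b' hb', SlashAction.slash_mul]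
    congr 1
    have hmem : betaConj γ b' hb' ∈ Gamma1 (N * p) := by
      obtain ⟨e00, e01, e10, e11⟩ := betaConj_apply γ b' hb'
      rw [mem_gamma1_iff, e00, e11, e10]
      push_cast
      exact ⟨ha, hd, mul_comm (p : ℤ) N ▸ mul_dvd_mul_left (p : ℤ) hc⟩
    exact SlashInvariantFormClass.slash_action_eq G _ ⟨_, hmem, rfl⟩

/-- **The descended form**: for `G ∈ S_k(Γ₁(Np))` with `a_n(G) = 0` whenever `p ∤ n` (`p` prime,
`p ∤ N`), the cusp form `G ∣[k] diag(1, p)` (a constant multiple of `G(τ/p)`) of level `Γ₁(N)`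
(holomorphy and vanishing at the cusps — all of `ℙ¹(ℚ)` for both arithmetic groups — are those of
Mathlib's `CuspForm.translate`). [folklore] -/
def descend (hp : p.Prime) (hpN : ¬ p ∣ N) (G : CuspForm (Gamma1 (N * p)) k)
    (hG : ∀ n, ¬ p ∣ n → cuspCoeff G n = 0) : CuspForm (Gamma1 N) k where
  toFun := (⇑G : ℍ → ℂ) ∣[k] glCast (betaQ p : GL (Fin 2) ℚ)
  slash_action_eq' := by
    rintro - ⟨γ, hγ, rfl⟩
    exact gamma1_le_slashStab hp hpN G hG hγ
  holo' := (CuspForm.translate G (glCast (betaQ p : GL (Fin 2) ℚ))).holo'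
  zero_at_cusps' hc :=
    (CuspForm.translate G (glCast (betaQ p : GL (Fin 2) ℚ))).zero_at_cusps'
      ((Subgroup.IsArithmetic.isCusp_iff_isCusp_SL2Z _).mpr
        ((Subgroup.IsArithmetic.isCusp_iff_isCusp_SL2Z _).mp hc))

/-- The underlying function of `descend`. [folklore] -/
@[simp] theorem coe_descend (hp : p.Prime) (hpN : ¬ p ∣ N) (G : CuspForm (Gamma1 (N * p)) k)
    (hG : ∀ n, ¬ p ∣ n → cuspCoeff G n = 0) :
    (⇑(descend hp hpN G hG) : ℍ → ℂ) = (⇑G : ℍ → ℂ) ∣[k] glCast (betaQ p : GL (Fin 2) ℚ) := rfl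

/-- **`[α_p]_k (descend G) = p^{k-2} G`** (`β α_p = p · 1`). [folklore] -/
theorem degeneracyMap1_descend (hp : p.Prime) (hpN : ¬ p ∣ N) (G : CuspForm (Gamma1 (N * p)) k)
    (hG : ∀ n, ¬ p ∣ n → cuspCoeff G n = 0) :
    degeneracyMap1 N (N * p) p k (descend hp hpN G hG) = ((p : ℂ) ^ (k - 2)) • G := by
  apply DFunLike.coe_injective
  rw [coe_degeneracyMap1_eq_slash N (N * p) p k dvd_rfl, coe_descend, ← SlashAction.slash_mul,
    beta_mul_alpha, slash_diagGL_self]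
  rfl

/-- **Level descent for forms with `q`-expansion in `q^p`**: every `G ∈ S_k(Γ₁(Np))` with
`a_n(G) = 0` for `p ∤ n` is `[α_p]_k F` for a (unique) `F ∈ S_k(Γ₁(N))` (`p` prime, `p ∤ N`;
Diamond–Shurman §5.7: the image of `ι_p` is the space of forms in `q^p`). [folklore] -/
theorem exists_degeneracyMap1_eq (hp : p.Prime) (hpN : ¬ p ∣ N) (G : CuspForm (Gamma1 (N * p)) k)
    (hG : ∀ n, ¬ p ∣ n → cuspCoeff G n = 0) :
    ∃ F : CuspForm (Gamma1 N) k, degeneracyMap1 N (N * p) p k F = G := by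
  have hpC : (p : ℂ) ≠ 0 := Nat.cast_ne_zero.mpr (NeZero.ne p)
  refine ⟨((p : ℂ) ^ (2 - k)) • descend hp hpN G hG, ?_⟩
  rw [map_smul, degeneracyMap1_descend, smul_smul, ← zpow_add₀ hpC, show 2 - k + (k - 2) = 0 by ring,
    zpow_zero, one_smul]

/-- `[α_p]_k` is injective (`a_n(F) = p^{1-k} a_{pn}([α_p]_k F)`). [folklore] -/
theorem degeneracyMap1_injective {M : ℕ} [NeZero M] (hMd : N * p ∣ M) :
    Function.Injective (degeneracyMap1 N M p k) := by
  intro F₁ F₂ h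
  have hpC : (p : ℂ) ≠ 0 := Nat.cast_ne_zero.mpr (NeZero.ne p)
  refine eq_of_forall_cuspCoeff_eq (HeckeTGamma1.one_mem_strictPeriods_Gamma1 N) fun n ↦ ?_
  have h1 := cuspCoeff_degeneracyMap1 (N := M) (k := k) hMd F₁ (p * n)
  have h2 := cuspCoeff_degeneracyMap1 (N := M) (k := k) hMd F₂ (p * n)
  rw [h, h2] at h1
  simp only [if_pos (dvd_mul_right p n), Nat.mul_div_cancel_left n (NeZero.pos p)] at h1
  exact (mul_left_cancel₀ (zpow_ne_zero _ hpC) h1).symm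

end Descend

/-! ### 5. Deligne–Serre (2.7.2): descent from level `Np` to level `N` (`p` prime, `p ∤ N`) -/

section Main

variable {N : ℕ} [NeZero N] {p : ℕ} [NeZero p] {k : ℤ}

/-- Fourier coefficients of a finite linear combination. [folklore] -/
theorem cuspCoeff_sum_smul_gamma1 {M : ℕ} {ι : Type*} (s : Finset ι) (a : ι → ℂ)
    (x : ι → CuspForm (Gamma1 M) k) (n : ℕ) :
    cuspCoeff (∑ i ∈ s, a i • x i) n = ∑ i ∈ s, a i * cuspCoeff (x i) n := by
  rw [← cuspCoeffₗ_apply (HeckeTGamma1.one_mem_strictPeriods_Gamma1 M), map_sum]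
  simp only [map_smul, cuspCoeffₗ_apply, smul_eq_mul]

/-- **Level descent for Deligne–Serre 1974, (2.7.2).**  If Deligne–Serre's integral lattice of
level `Np` spans `S_k(Γ₁(Np))` over `ℂ`, `p` a prime not dividing `N`, then the integral lattice
of level `N` spans `S_k(Γ₁(N))`.  Proof: `ι = [α_p]_k : S_k(Γ₁(N)) → S_k(Γ₁(Np))` multiplies
`q`-expansions by `p^{k-1}` and substitutes `q ↦ q^p` (`cuspCoeff_degeneracyMap1`), and its image
is exactly the forms whose coefficients vanish off the multiples of `p`
(`exists_degeneracyMap1_eq`) — a system of linear equations with integer coefficients on the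
lattice coordinates, so its complex solutions are spanned by rational ones
(`exists_algebraMap_coords`, as in `DeligneSerre1974_span_integralLattice1.of_weight_add`); a
rational solution `ι F = ∑ qᵢ gᵢ` gives `p^{k-1} D F ∈ L_N`, because the diamond operators
commute with `ι` (`diamondOp_degeneracyMap1`, `(ℤ/Npℤ)ˣ → (ℤ/Nℤ)ˣ` onto) and
`a_n(⟨d⟩ F) = p^{1-k} a_{pn}(⟨d₁⟩ ι F)`. [folklore] -/
theorem DeligneSerre1974_span_integralLattice1.of_mul_prime (hp : p.Prime) (hpN : ¬ p ∣ N)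
    (H : DeligneSerre1974_span_integralLattice1 (N * p) k) :
    DeligneSerre1974_span_integralLattice1 N k := by
  classical
  intro hk
  have hpC : (p : ℂ) ≠ 0 := Nat.cast_ne_zero.mpr hp.ne_zero
  have hNp : N * p ∣ N * p := dvd_rfl
  rw [eq_top_iff]
  rintro f -
  -- Step 1: `ι f` is a complex combination of lattice forms of level `Np`
  obtain ⟨t₀, α, g, hg⟩ := Submodule.mem_span_set'.mp
    (show degeneracyMap1 N (N * p) p k f ∈
        Submodule.span ℂ (integralLattice1 (N * p) k : Set _) by
      rw [H hk]; trivial)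
  have hA' : ∀ (i : Fin t₀) (n : ℕ), ∃ z : ℤ,
      (z : ℂ) = cuspCoeff (g i : CuspForm (Gamma1 (N * p)) k) n :=
    fun i ↦ exists_int_eq_cuspCoeff_of_mem_integralLattice1 (g i).2
  choose A hA using hA'
  -- Step 2: rational coordinates `q` for `α` on `c : Fin t → ℂ`
  obtain ⟨t, c, q, hγ, hrel⟩ :
      ∃ (t : ℕ) (c : Fin t → ℂ) (q : Fin t₀ → Fin t → ℚ),
        (∀ i, α i = ∑ l, (q i l : ℂ) * c l) ∧
        ∀ r : Fin t₀ → ℚ, ∑ i, (r i : ℂ) * α i = 0 → ∀ l, ∑ i, r i * q i l = 0 := by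
    simpa only [eq_ratCast] using
      Literature.LinearAlgebra.BaseChange.exists_algebraMap_coords ℚ α
  -- Step 3: the integer relations `∑ᵢ αᵢ a_n(gᵢ) = a_n(ι f) = 0` for `p ∤ n`
  have hrelation : ∀ n : ℕ, ¬ p ∣ n → ∑ i, ((A i n : ℚ) : ℂ) * α i = 0 := by
    intro n hn
    have e1 : cuspCoeff (degeneracyMap1 N (N * p) p k f) n = 0 := by
      rw [cuspCoeff_degeneracyMap1 (N := N * p) (k := k) hNp f n, if_neg hn, mul_zero]
    rw [← hg, cuspCoeff_sum_smul_gamma1] at e1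
    simpa only [Rat.cast_intCast, hA, mul_comm (α _)] using e1
  -- Step 4: the rational combinations `G l = ∑ᵢ q_{il} gᵢ` have `q`-expansion in `q^p`
  set G : Fin t → CuspForm (Gamma1 (N * p)) k := fun l ↦
    ∑ i, ((q i l : ℚ) : ℂ) • (g i : CuspForm (Gamma1 (N * p)) k) with hGdef
  have hGcoeff : ∀ l n, ¬ p ∣ n → cuspCoeff (G l) n = 0 := by
    intro l n hn
    have hq := hrel _ (hrelation n hn) l
    have hq' := congrArg (fun r : ℚ ↦ (r : ℂ)) hq
    simp only [Rat.cast_sum, Rat.cast_mul, Rat.cast_intCast, hA, Rat.cast_zero] at hq'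
    rw [hGdef]
    dsimp only
    rw [cuspCoeff_sum_smul_gamma1]
    simpa only [mul_comm] using hq'
  -- Step 5: descend: `G l = ι (F l)` with `F l ∈ S_k(Γ₁(N))`
  choose F hF using fun l ↦ exists_degeneracyMap1_eq hp hpN (G l) (hGcoeff l)
  -- Step 6: `f = ∑ₗ cₗ Fₗ` (`ι` is injective)
  have hfsum : f = ∑ l, c l • F l := by
    apply degeneracyMap1_injective (k := k) hNp
    rw [map_sum]
    simp only [map_smul, hF]
    rw [← hg]
    simp only [hGdef, Finset.smul_sum, smul_smul, hγ, Finset.sum_smul]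
    rw [Finset.sum_comm]
    exact Finset.sum_congr rfl fun i _ ↦ Finset.sum_congr rfl fun l _ ↦
      congrArg (fun x : ℂ ↦ x • (g l : CuspForm (Gamma1 (N * p)) k)) (mul_comm _ _)
  -- Step 7: each `F l` lies in `ℚ L_N`: clear denominators, `p^{k-1}`, and move the diamonds through `ι`
  have hFmem : ∀ l,
      F l ∈ Submodule.span ℂ (integralLattice1 N k : Set (CuspForm (Gamma1 N) k)) := by
    intro l
    set D : ℕ := ∏ i, (q i l).den with hD
    have hD0 : (D : ℂ) ≠ 0 := by
      rw [Nat.cast_ne_zero, hD]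
      exact Finset.prod_ne_zero_iff.mpr fun i _ ↦ (q i l).den_ne_zero
    have hDq : ∀ i, ∃ z : ℤ, (z : ℚ) = D * q i l := by
      intro i
      obtain ⟨m, hm⟩ : (q i l).den ∣ D := Finset.dvd_prod_of_mem _ (Finset.mem_univ i)
      refine ⟨m * (q i l).num, ?_⟩
      rw [hm]
      push_cast
      rw [← Rat.mul_den_eq_num (q i l)]
      ring
    choose z hz using hDq
    have hDG : (D : ℂ) • G l ∈ integralLattice1 (N * p) k := by
      have : (D : ℂ) • G l = ∑ i, (z i : ℤ) • (g i : CuspForm (Gamma1 (N * p)) k) := by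
        rw [hGdef]
        dsimp only
        rw [Finset.smul_sum]
        refine Finset.sum_congr rfl fun i _ ↦ ?_
        rw [smul_smul, ← Int.cast_smul_eq_zsmul ℂ, ← Rat.cast_intCast (α := ℂ), hz i]
        push_cast
        rfl
      rw [this]
      exact Submodule.sum_mem _ fun i _ ↦ Submodule.smul_mem _ _ (g i).2
    set E : ℂ := (p : ℂ) ^ (k - 1) * D with hE
    have hE0 : E ≠ 0 := mul_ne_zero (zpow_ne_zero _ hpC) hD0
    have hEF : E • F l ∈ integralLattice1 N k := by
      rw [mem_integralLattice1]
      intro d n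
      obtain ⟨d₁, hd₁⟩ := ZMod.unitsMap_surjective (dvd_mul_right N p) d
      have hmem : diamondOp (N * p) k (d₁ : ZMod (N * p)) ((D : ℂ) • G l) ∈
          integralLattice1 (N * p) k := diamondOp_mem_integralLattice1 hDG d₁
      obtain ⟨w, hw⟩ := exists_int_eq_cuspCoeff_of_mem_integralLattice1 hmem (p * n)
      refine ⟨w, ?_⟩
      have key : diamondOp (N * p) k (d₁ : ZMod (N * p)) ((D : ℂ) • G l) =
          degeneracyMap1 N (N * p) p k (diamondOp N k (d : ZMod N) ((D : ℂ) • F l)) := by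
        rw [← hF l, ← map_smul, diamondOp_degeneracyMap1 (N * p) k hNp d₁.isUnit]
        congr 2
        rw [← hd₁, ZMod.unitsMap_def, Units.coe_map]
        rfl
      rw [hw, key, cuspCoeff_degeneracyMap1 (N := N * p) (k := k) hNp, if_pos (dvd_mul_right p n),
        Nat.mul_div_cancel_left n hp.pos, hE, mul_smul, map_smul, cuspCoeff_smul_gamma1, map_smul,
        map_smul, cuspCoeff_smul_gamma1, cuspCoeff_smul_gamma1]
    have : F l = E⁻¹ • (E • F l) := by rw [smul_smul, inv_mul_cancel₀ hE0, one_smul]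
    rw [this]
    exact Submodule.smul_mem _ _ (Submodule.subset_span hEF)
  rw [hfsum]
  exact Submodule.sum_mem _ fun l _ ↦ Submodule.smul_mem _ _ (hFmem l)

end Main

end LevelDescent

/-! ### 6. Deligne–Serre 1974, Prop. 2.7 (2.7.2) at every level -/

section Holds

variable (N : ℕ) [NeZero N] (k : ℤ)

/-- **Deligne–Serre 1974, Prop. 2.7 (2.7.2)**: for every `N ≥ 1` and every weight `k ≥ 1`, the
`ℤ`-module `L` of cusp forms on `Γ₁(N)` all of whose diamond twists `⟨d⟩ f` have Fourier
coefficients in `ℤ` spans `S_k(Γ₁(N))` over `ℂ` — *"`L ⊗ ℂ → S_ℂ` est un isomorphisme"* — i.e. the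
named fact `DeligneSerre1974_span_integralLattice1 N k` holds.  For `N ≥ 5` this is
`ManinK.span_integralLattice1_of_five_le` (rank half of Eichler–Shimura for `Γ₁(N)` in every
weight, Shimura's lattice (3.5.20) and Thm. 3.52, weight descent by `E₄`, `E₆`); for `N ≤ 4` it
descends from level `5N` by `LevelDescent.DeligneSerre1974_span_integralLattice1.of_mul_prime`
with `p = 5 ∤ N`. [cite: DeligneSerreASENS1974, Prop. 2.7 (2.7.2)] -/
theorem DeligneSerre1974_span_integralLattice1_holds : DeligneSerre1974_span_integralLattice1 N k := by
  by_cases hN : 5 ≤ N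
  · exact ManinK.span_integralLattice1_of_five_le N hN k
  · have h5 : ¬ 5 ∣ N := fun h ↦ hN (Nat.le_of_dvd (NeZero.pos N) h)
    have h5N : 5 ≤ N * 5 := Nat.le_mul_of_pos_left 5 (NeZero.pos N)
    exact LevelDescent.DeligneSerre1974_span_integralLattice1.of_mul_prime (by norm_num) h5
      (ManinK.span_integralLattice1_of_five_le (N * 5) h5N k)

end Holds

end Literature.NumberTheory.EllipticCurves.ModularForms
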